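import Mathlib.Geometry.Manifold.Bordism
import Mathlib.SetTheory.Cardinal.Finite
import Literature.Topology.FourManifolds.Bordism
import Literature.Topology.FourManifolds.Cobordism
import Literature.Topology.FourManifolds.LatticeForms
import Literature.Topology.FourManifolds.IntersectionLattice
import Literature.Topology.FourManifolds.ComplexProjectiveSpace
import Literature.AlgebraicTopology.SingularHomology.SingularChains
import Literature.AlgebraicTopology.SingularHomology.RelativeHomology
import Literature.AlgebraicTopology.SingularHomology.FundamentalClass
import Literature.AlgebraicTopology.SingularHomology.IntersectionForm
import HarnessLib

-- D-0014 sorry-sweep (operator, 2026-08-13): sorried theorems -> named facts `def X : Prop`; partial proofs preserved in comments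
-- provenance: harness21/H21/H21/Statements/SPC4/BordismFour.lean @ a5e76dc (interim HEAD d8f2665); M5 mechanical rewrite
/-!
# SPC4 — bordism in dimension four (family `spc4`, trunk T-4MAN, outline §3 / D6)

Family `spc4` of the H21 statement library: Thom's computation of the bordism groups in
dimension `4`.  The oriented bordism group `Ω₄^SO` is infinite cyclic, detected by the signature
and generated by `ℂℙ²` (Thom 1954; Rokhlin 1952); the unoriented bordism group `𝔑₄` is
`(ℤ/2)²`, generated by `ℂℙ²` and `ℝℙ⁴` (Thom 1954).  Milnor–Stasheff, *Characteristic classes*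
(1974), §17–§18.

## Setting

As in `Literature.Statements.SPC4.Wave0`: a closed topological 4-manifold ("TOP4") is `M : Type u` with
`[TopologicalSpace M] [T2Space M] [SecondCountableTopology M] [ChartedSpace (𝔼 4) M]
[CompactSpace M]`; "DIFF4" adds `[IsManifold (𝓡 4) ∞ M]`.  Orientations are G04's homological
orientations `μ : Literature.HomologicalOrientation ℤ M 4` (`Literature.Prelude.AlgTop.Orientation`), with
fundamental class `μ.fundamentalClass ∈ H₄(M; ℤ)` (`Literature.Prelude.AlgTop.FundamentalClass`); the
intersection form is always `Literature.intersectionForm two_add_two_eq_four μ` and the signature of an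
oriented 4-manifold is the prelude abbreviation `μ.signature`
(`Literature.Prelude.FourManM.IntersectionLattice`).  Unoriented bordism classes
`Literature.UnorientedBordismClass n` (Thom's `𝔑ₙ` as a type, with Hausdorff carriers) and cobordisms
`Literature.Cobordism n M N` come from `Literature.Prelude.FourManM.Bordism` / `.Cobordism`.

## Oriented bordism, honestly

Mathlib has no orientation of smooth manifolds and no induced boundary orientation, so
"`∂W = M ⊔ (−N)` as oriented manifolds" is expressed homologically (outline D6):
`Literature.SPC4.IsOrientedBordant n μ ν` asks for a cobordism `c : Cobordism n M N` and a relative class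
`w ∈ H_{n+1}(W, ∂W; ℤ)` whose image under the connecting homomorphism
`∂ : H_{n+1}(W, ∂W; ℤ) → Hₙ(∂W; ℤ)` is `(inl)_* [M]_μ − (inr)_* [N]_ν`.  See the docstring of
`IsOrientedBordant` for the (informal) equivalence with the classical notion.

## Covered statement ids

* `spc4.S36` (Thom 1954; Rokhlin 1952; Milnor–Stasheff §17–18): `isOrientedBordant_iff_signature_eq`
  (`Ω₄^SO ↪ ℤ` via `σ`), `exists_signature_eq` (surjectivity of `σ`),
  `exists_signature_complexProjectivePlane_eq_one` (`ℂℙ²` generates),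
  `natCard_unorientedBordismClass_four` (`|𝔑₄| = 4`, which together with the prelude's
  `BordismClass.add_self_eq_zero` gives `𝔑₄ ≅ (ℤ/2)²`), and
  `unorientedBordismClass_mk_complexProjectivePlane_ne_zero` (`[ℂℙ²] ≠ 0` in `𝔑₄`).

## Deliberately not stated

* The group structure on oriented bordism classes (no quotient type `Ω₄^SO` is built; the
  statements are phrased relationally through `IsOrientedBordant` and the signature).
* `[ℝℙ⁴] ≠ 0` and `[ℝℙ⁴] ≠ [ℂℙ²]` in `𝔑₄` (no `ℝℙ⁴` as a charted space in the library yet); the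
  second generator is only mentioned in docstrings.
* Stiefel–Whitney and Pontryagin numbers (Thom's general theorems); only the dimension-4
  consequences are recorded.

## Mathlib

`Mathlib/Geometry/Manifold/Bordism.lean` (M. Rothgang) has `SingularManifold` and a roadmap
towards unoriented bordism groups, but no bordism relation, no bordism group and nothing
oriented; `rg -i 'oriented bordism|signature' Mathlib/Geometry/Manifold` finds nothing relevant.
`Nat.card` is Mathlib's (`Mathlib/SetTheory/Cardinal/Finite.lean`).
-/

open scoped Manifold ContDiff Topology ContinuousMap
open ContinuousMap CategoryTheory

noncomputable section

namespace Literature.Topology.FourManifolds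

universe u

/-- Local notation: `𝔼 n` is the model Euclidean space `EuclideanSpace ℝ (Fin n)`. -/
local notation "𝔼 " n:arg => EuclideanSpace ℝ (Fin n)

/-- Local notation: `Q⟦μ⟧` is the intersection form of the `ℤ`-oriented closed 4-manifold
`(M, μ)` on `H²(M; ℤ)/T` (G04's `Literature.intersectionForm two_add_two_eq_four μ`). -/
local notation "Q⟦" μ "⟧" => Literature.AlgebraicTopology.SingularHomology.intersectionForm two_add_two_eq_four μ

/-! ### Oriented bordism via fundamental classes -/

/-- Two closed `ℤ`-oriented topological `n`-manifolds `(M, μ)` and `(N, ν)` are *oriented bordant*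
if there is a (smooth, compact) cobordism `W` from `M` to `N` (`c : Literature.Cobordism n M N`, so
`∂W = inl M ⊔ inr N`) and a relative class `w ∈ H_{n+1}(W, ∂W; ℤ)` with
`∂ w = (inl)_* [M]_μ − (inr)_* [N]_ν` in `Hₙ(∂W; ℤ)`, where `∂` is the connecting homomorphism
of the pair `(W, ∂W)` (G04's `relativeSingularHomology.δ`, in the `(X, A : Set X)` convention
with `A := (𝓡∂ (n + 1)).boundary W`) and `inl`, `inr` are corestricted to `∂W`
(`Cobordism.inlBoundary`, `Cobordism.inrBoundary`).

This is equivalent to the classical definition (an oriented `W` with `∂W = M ⊔ (−N)` as oriented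
manifolds; Milnor–Stasheff (1974), §17, p. 200): if `W` is oriented compatibly then its relative
fundamental class `w = [W, ∂W]` satisfies `∂[W, ∂W] = [∂W] = [M] − [N]` (Hatcher, *Algebraic
Topology* (2002), §3.3, pp. 253–254 and Thm 3.43; Bredon, *Topology and Geometry* (1993), §VI.9).
Conversely, `H_{n+1}(W, ∂W; ℤ)` is the direct sum over the components `Wᵢ` of `W`; a component
that is not `ℤ`-orientable has `H_{n+1}(Wᵢ, ∂Wᵢ; ℤ) = 0` and so contributes nothing to `∂ w`,
while on an orientable component `∂` is injective on `H_{n+1}(Wᵢ, ∂Wᵢ; ℤ) ≅ ℤ` with image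
spanned by `[∂Wᵢ]`; comparing local generators, `∂ w = (inl)_*[M] − (inr)_*[N]` forces every
boundary component to lie in an orientable `Wᵢ` whose orientation class is `± [Wᵢ, ∂Wᵢ]`
inducing `μ` on `M ∩ ∂Wᵢ` and `−ν` on `N ∩ ∂Wᵢ`; discarding the non-orientable closed
components gives an oriented bordism.  Only the topology and the charted-space structure of `M`,
`N` are needed to state the relation; the closed-manifold instances (Hausdorff, second countable,
compact — which make `fundamentalClass` meaningful) and smoothness are added by consumers (the
type `Cobordism n M N` is empty for non-closed or non-smooth `M`, `N`).  Outline `FourManM.md`,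
D6. [cite: MilnorStasheffAMS76, §17 p. 200] -/
def IsOrientedBordant (n : ℕ) {M N : Type u} [TopologicalSpace M] [ChartedSpace (𝔼 n) M]
    [TopologicalSpace N] [ChartedSpace (𝔼 n) N]
    (μ : Literature.AlgebraicTopology.SingularHomology.HomologicalOrientation ℤ M n) (ν : Literature.AlgebraicTopology.SingularHomology.HomologicalOrientation ℤ N n) : Prop :=
  ∃ c : Cobordism n M N,
    ∃ w : ↥(Literature.AlgebraicTopology.SingularHomology.relativeSingularHomology ℤ ℤ c.W ((𝓡∂ (n + 1)).boundary c.W) (n + 1)),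
      Literature.AlgebraicTopology.SingularHomology.relativeSingularHomology.δ ℤ ℤ c.W ((𝓡∂ (n + 1)).boundary c.W) n w =
        Literature.AlgebraicTopology.SingularHomology.singularHomology.map ℤ ℤ c.inlBoundary n μ.fundamentalClass -
          Literature.AlgebraicTopology.SingularHomology.singularHomology.map ℤ ℤ c.inrBoundary n ν.fundamentalClass

/-! ### spc4.S36: `Ω₄^SO ≅ ℤ` via the signature, `𝔑₄ ≅ (ℤ/2)²` -/

/-- **spc4.S36** (Thom, *Quelques propriétés globales des variétés différentiables*, Comment.
Math. Helv. 28 (1954), Thm IV.13; Rokhlin, Dokl. Akad. Nauk SSSR 84 (1952); Milnor–Stasheff,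
*Characteristic classes* (1974), §17–§18, Thm 18.9 ff. and Lemma 17.3).  **The oriented bordism
group in dimension four is detected by the signature**: two closed oriented smooth 4-manifolds
`(M, μ)`, `(N, ν)` are oriented bordant (through a compact smooth 5-manifold `W`) if and only if
`σ(M, μ) = σ(N, ν)`.  The forward direction is bordism invariance of the signature (Thom); the
converse is `Ω₄^SO ≅ ℤ` (Thom; Rokhlin).  Together with `exists_signature_eq` this says
`σ : Ω₄^SO → ℤ` is an isomorphism. [cite: ThomCMH1954, Thm IV.13] -/
def isOrientedBordant_iff_signature_eq : Prop :=
  ∀ {M N : Type u} [TopologicalSpace M] [T2Space M] [SecondCountableTopology M] [ChartedSpace (𝔼 4) M] [CompactSpace M] [IsManifold (𝓡 4) ∞ M] [TopologicalSpace N] [T2Space N] [SecondCountableTopology N] [ChartedSpace (𝔼 4) N] [CompactSpace N] [IsManifold (𝓡 4) ∞ N] (μ : Literature.AlgebraicTopology.SingularHomology.HomologicalOrientation ℤ M 4) (ν : Literature.AlgebraicTopology.SingularHomology.HomologicalOrientation ℤ N 4),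
    IsOrientedBordant 4 μ ν ↔ μ.signature = ν.signature

/-- **spc4.S36** (Thom 1954, Thm IV.13; Milnor–Stasheff (1974), §17–§18).  **The signature
`Ω₄^SO → ℤ` is surjective**: every integer is the signature of some closed oriented smooth
4-manifold (a disjoint union of `|s|` copies of `ℂℙ²`, or of `ℂℙ²` with the reversed orientation;
connected sums also work). [cite: ThomCMH1954, Thm IV.13] -/
def exists_signature_eq : Prop :=
  ∀ (s : ℤ),
    ∃ (M : Type) (_ : TopologicalSpace M) (_ : T2Space M) (_ : SecondCountableTopology M)
      (_ : ChartedSpace (𝔼 4) M) (_ : CompactSpace M) (_ : IsManifold (𝓡 4) ∞ M)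
      (μ : Literature.AlgebraicTopology.SingularHomology.HomologicalOrientation ℤ M 4), μ.signature = s

/-- **spc4.S36** (Thom 1954, Thm IV.13; Milnor–Stasheff (1974), §14 and Thm 18.9: `ℂℙ²`
generates `Ω₄^SO ≅ ℤ`).  The complex projective plane carries a `ℤ`-orientation of signature `1`:
`H²(ℂℙ²; ℤ) ≅ ℤ` generated by `a` with `⟨a ⌣ a, [ℂℙ²]⟩ = 1` for the complex orientation
(Milnor–Stasheff (1974), Thm 14.10; Gompf–Stipsicz (1999), Example 1.2.4).  Uses the prelude's
`ChartedSpace (𝔼 4) ComplexProjectivePlane` instance (`Literature.Prelude.FourManM.ComplexProjectiveSpace`). [cite: ThomCMH1954, Thm IV.13] -/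
def exists_signature_complexProjectivePlane_eq_one : Prop :=
  ∃ μ : Literature.AlgebraicTopology.SingularHomology.HomologicalOrientation ℤ ComplexProjectivePlane 4, μ.signature = 1

/-- **spc4.S36** (Thom, Comment. Math. Helv. 28 (1954), Thm IV.12: `𝔑₄ ≅ ℤ/2 ⊕ ℤ/2`, generated
by `ℂℙ²` and `ℝℙ⁴`; Milnor–Stasheff (1974), §17, p. 203).  **The unoriented bordism group in
dimension four has exactly four elements.**  Since every class satisfies `a + a = 0`
(`Literature.Topology.FourManifolds.BordismClass.add_self_eq_zero`), this is `𝔑₄ ≅ (ℤ/2)²`; the four classes are `0`, `[ℂℙ²]`,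
`[ℝℙ⁴]`, `[ℂℙ² ⊔ ℝℙ⁴]`, distinguished by the Stiefel–Whitney numbers `w₄`, `w₂²` (`w₁⁴ = w₂²`
and `w₁²w₂ = 0` on every closed 4-manifold).  Stated in universe `0`; the carriers of
`UnorientedBordismClass` are Hausdorff (`Literature.Topology.FourManifolds.ClosedSingularManifold`), which is what makes the
count meaningful. [cite: ThomCMH1954, Thm IV.12] -/
def natCard_unorientedBordismClass_four : Prop :=
  Nat.card (UnorientedBordismClass.{0} 4) = 4

/-- **spc4.S36** (Thom 1954, Thm IV.12; Milnor–Stasheff (1974), §4, Example 4 p. 52 and §17: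
a closed manifold bounding a compact manifold has vanishing Stiefel–Whitney numbers, Pontryagin's
theorem 4.9, while `w₄[ℂℙ²] = χ(ℂℙ²) mod 2 = 1`).  **`ℂℙ²` is not a boundary**: its unoriented
bordism class is non-zero, so `[ℂℙ²]` is one of the two generators of `𝔑₄ ≅ (ℤ/2)²` (the other
being `[ℝℙ⁴]`).  Uses the prelude instances `IsManifold (𝓡 4) ∞`, `CompactSpace`, `T2Space`,
`BoundarylessManifold (𝓡 4)` on `ComplexProjectivePlane`. [cite: ThomCMH1954, Thm IV.12] -/
def unorientedBordismClass_mk_complexProjectivePlane_ne_zero : Prop :=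
  UnorientedBordismClass.mk ComplexProjectivePlane ≠ (0 : UnorientedBordismClass.{0} 4)

end Literature.Topology.FourManifolds

end
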